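import Literature.NumberTheory.Automorphic.Liu2021.Prop413MultOneAsPrinted
import Literature.NumberTheory.Automorphic.Liu2021.Def411AsPrinted
import Literature.RepresentationTheory.AdmissibleDirectSumMultiplicityOne
import Literature.RepresentationTheory.Liu2021.GlobalOscillatorIsomorphismCriterion
import HarnessLib

/-!
# [Liu 2021] Prop. 4.13 AS PRINTED ⟹ multiplicity one (proof of Prop. 4.13, l. 2145) — the incremental difference, proved

Y. Liu, *Fourier–Jacobi cycles and arithmetic relative trace formula*, Camb. J. Math. **9** (2021) = arXiv:2102.11518
[Liu2021]; TeX source `FJcycle.tex` (md5 `6db49a74122d…`), §4.2: Prop. 4.13 (ll. 2113–2119), its proof's last sentence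
(l. 2145), Def. 4.11 (ll. 2083–2097), Thm. 4.18 (2) (l. 2241), App. D Lemma D.1 (3) (l. 5233).

## Why this file (Δ2 BRIDGE of the Hodge-CM cell, question Q2 of `BRIDGE-PLAN.md` §6)

The Δ2 junctions («[Liu2021] Thm. 4.18 AS PRINTED ⟹ the combined reading r8») consume the multiplicity bound
`hmult ∕ hmultD : Module.rank ℂ (Hom_{ℂ[𝔾(𝔸_F^∞)]}(ω_i, H)) ≤ 1`.  So far the tree supplies it ONLY as the record
`Prop413Data.MultOneAsPrinted` — the last sentence of the PROOF of Prop. 4.13 (l. 2145, «the dimension of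
`H¹_{B,τ'}(A_∞, ℂ)[ω(μ,ε,χ)]` is `1`»), typed with NO PROOF.  This file DERIVES that sentence in the kernel from the
STATEMENT of Prop. 4.13 as printed (`Prop413AsPrinted`: `H¹_{B,τ'}(A_∞, ℂ) ≃ ⊕_{(μ,ε,χ)} ω(μ,ε,χ)` as `ℂ[𝔾(𝔸_F^∞)]`-modules)
together with the two printed properties of the summands that the count silently uses:

* Def. 4.11 («`ω(μ,ε,χ)` … is an irreducible admissible representation of `𝔾(𝔸_F^∞)`», typed by `Def411AsPrinted`'s
  adjectives `IsIrreducibleOrZero ∧ IsSmoothRep ∧ IsAdmissibleRep`), and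
* pairwise non-isomorphy of the summands — Thm. 4.18 (2) («mutually non-isomorphic», same `μ`) together with the
  `μ`-separation that [Liu2021] obtains from App. D Lemma D.1 (3) («`ω(μ',ε',χ')` is isomorphic to `ω(μ,ε,χ)` if and only if
  `(μ',ε',χ') = (μ,ε,χ)`», local; globalised in the tree by `RepresentationTheory/Liu2021/GlobalOscillatorIsomorphismCriterion`)
  — carried here as ONE explicit hypothesis `hsep` in the shape of `Thm418Data.AreIsomorphic` over ALL admissible triples,

by Schur's lemma for irreducible admissible representations ([Bump1997, Prop. 4.2.4]; tree
`Representation.IsAdmissible.exists_eq_smul_id`) in its Hom-space form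
`Literature.RepresentationTheory.AdmissibleDirectSum.rank_intertwiningMap_le_one_of_equivariant_directSum`.
The only further input is the existence of ONE compact open subgroup of `𝔾(𝔸_F^∞)` (`hK`; at the cells' data every level
`K` is one).

## Main statements

* `Prop413Data.rank_intertwiningMap_le_one_of_asPrinted` — for ANY irreducible-or-zero `ρ` of `𝔾(𝔸_F^∞)`:
  `Module.rank ℂ (Hom_G(ρ, H¹_{B,τ'}(A_∞, ℂ))) ≤ 1` (the shape of the junction binder `hmultD`, whose source is a summand of a
  consumer's own `Thm418Data` and whose target is the consumer's `P.rhoB τ'`, e.g. `Representation.ofModule'` of its tower).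
* `Prop413Data.rank_intertwiningMap_rhoAt_le_one_of_asPrinted`, `…_toThm418Data_le_one_of_asPrinted` — at the summands
  `ω_t` ∕ at Thm. 4.18's indices over the same carriers (the shapes of `MultOneAsPrinted.rank_intertwiningMap_le_one` ∕
  `…_toThm418Data_le_one`).
* `Prop413Data.rank_intertwiningMap_rhoAt_eq_one_of_asPrinted` — `= 1` at a NON-ZERO summand, and
  `Prop413Data.multOneAsPrinted_of_asPrinted` — **the record `MultOneAsPrinted` itself**, from `Prop413AsPrinted` + Def. 4.11 +
  `hsep` + non-vanishing of the admissible weight-one summands (Lemma D.1 (1)) + `hK`.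

Everything is a theorem; no definition, no named fact, nothing about Liu's objects is constructed or asserted.
HC_CM is NOT proved here or anywhere by this file; «Δ2 BRIDGE CLOSED» is NOT claimed.
Seat prover-pub-hodgecm-own-htheta-g9-0 (Hodge-CM cell, own-htheta lineage; Δ2 BRIDGE question Q2), 2026-08-23.

## References
* [Liu2021] Prop. 4.13 (ll. 2113–2119) and proof l. 2145; Def. 4.11 (ll. 2083–2097); Thm. 4.18 (2) (l. 2241);
  App. D Lemma D.1 (1), (3) (ll. 5226–5233).
* [Bump1997] D. Bump, *Automorphic Forms and Representations*, CUP 1997, Prop. 4.2.4 (Schur's lemma, admissible case).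
* Tree: `Liu2021.Prop413AsPrinted`, `Liu2021.Prop413Data.MultOneAsPrinted`, `Liu2021.Def411AsPrinted`
  (`IsIrreducibleOrZero`, `IsSmoothRep`, `IsAdmissibleRep`), `Literature.RepresentationTheory.AdmissibleDirectSum.*`,
  `Representation.IsAdmissible` (`NumberTheory/Automorphic/SmoothRepresentation.lean`).
-/

noncomputable section

open NumberField
open Literature.RepresentationTheory

namespace Literature.NumberTheory.Automorphic.Liu2021

/-! ## Liu's printed adjectives (Def. 4.11) versus the tree's `Representation.IsAdmissible` -/

section Adjectives

variable {G V : Type} [Group G] [AddCommGroup V] [Module ℂ V] {ρ : Representation ℂ G V}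

/-- «irreducible» in Liu's sense (zero allowed) gives Mathlib-irreducible on a non-zero space — restated as an implication
`Nontrivial V → ρ.IsIrreducible`, the hypothesis shape of `AdmissibleDirectSum.rank_intertwiningMap_le_one_of_equivariant_directSum`.
[cite: Liu2021, Def. 4.11] -/
theorem isIrreducible_of_isIrreducibleOrZero (h : IsIrreducibleOrZero ρ) (hV : Nontrivial V) : ρ.IsIrreducible := by
  haveI := hV
  exact isIrreducible_of_nontrivial h

variable [TopologicalSpace G]

/-- «admissible representation» in the sense of [Liu2021] Def. 4.11 (READING I2 of `Def411AsPrinted`: smooth — every vector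
fixed by an open subgroup — and finite-dimensional fixed vectors under every open compact subgroup) IS the tree's
`Representation.IsAdmissible` (open stabilisers; finitely generated `K`-fixed vectors for compact open `K`).
[cite: Liu2021, Def. 4.11] -/
theorem isAdmissible_of_isSmoothRep_of_isAdmissibleRep [IsTopologicalGroup G] (hs : IsSmoothRep ρ)
    (ha : IsAdmissibleRep ρ) :
    ρ.IsAdmissible := by
  refine ⟨fun v => ?_, fun K hK => ha K ⟨K.isOpen, hK⟩⟩
  obtain ⟨S, hSo, hS⟩ := hs v
  exact ρ.isSmoothVector_of_le hSo fun g hg => (ρ.mem_stabilizerSubgroup v g).2 (hS g hg)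

/-- Conversely the tree's `Representation.IsAdmissible` gives Liu's two adjectives (as `LemD1_1AsPrinted.isSmoothRep ∕
isAdmissibleRep` do for the local datum). [cite: Liu2021, Def. 4.11] -/
theorem isSmoothRep_and_isAdmissibleRep_of_isAdmissible (h : ρ.IsAdmissible) :
    IsSmoothRep ρ ∧ IsAdmissibleRep ρ :=
  ⟨fun v => ⟨ρ.stabilizerSubgroup v, h.isSmooth v, fun _ hk => hk⟩,
    fun K hK => h.finite_fixedPoints ⟨K, hK.1⟩ hK.2⟩

end Adjectives

namespace Prop413Data

variable {F E : Type} [Field F] [NumberField F] [IsTotallyReal F] [Field E] [NumberField E] [Algebra F E]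
  [IsTotallyComplex E] [Algebra.IsQuadraticExtension F E] {P : Prop413Data F E}

/-- **Multiplicity at most one into `H¹_{B,τ'}(A_∞, ℂ)`, from Prop. 4.13 AS PRINTED** (the `hmultD` shape of the Δ2
junctions).  Inputs, each by name: `h : Prop413AsPrinted P` with `3 ≤ P.n` (the `ℂ[𝔾(𝔸_F^∞)]`-isomorphism
`H¹_{B,τ'}(A_∞, ℂ) ≃ ⊕_t ω_t`, l. 2113–2119); `h411` = Def. 4.11's printed adjectives of every summand `ω_t` (irreducible —
zero allowed —, smooth, admissible; the conjunct shape of `Def411AsPrinted`); `hsep` = the summands are pairwise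
non-isomorphic (Thm. 4.18 (2) for equal `μ`, the `μ`-separation from App. D Lemma D.1 (3) otherwise; `Thm418Data.AreIsomorphic`
shape, guarded by non-vanishing); `hK` = `𝔾(𝔸_F^∞)` has a compact open subgroup.  Conclusion: for EVERY representation `ρ` of
`𝔾(𝔸_F^∞)` that is irreducible or zero, `dim_ℂ Hom_{ℂ[𝔾(𝔸_F^∞)]}(ρ, H¹_{B,τ'}(A_∞, ℂ)) ≤ 1` (bundled intertwining maps).  Proof:
Schur's lemma for irreducible admissible representations ([Bump1997, Prop. 4.2.4]) in the Hom-space form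
`AdmissibleDirectSum.rank_intertwiningMap_le_one_of_equivariant_directSum`.
[cite: Liu2021, Prop. 4.13 (ll. 2113–2119) with proof l. 2145; Def. 4.11; Thm. 4.18 (2); App. D Lemma D.1 (3)] -/
theorem rank_intertwiningMap_le_one_of_asPrinted (h : Liu2021.Prop413AsPrinted P) (hn : 3 ≤ P.n) (τ' : E →+* ℂ)
    (h411 : ∀ t : P.AdmTriple,
      IsIrreducibleOrZero (P.rhoAt t) ∧ IsSmoothRep (P.rhoAt t) ∧ IsAdmissibleRep (P.rhoAt t))
    (hsep : ∀ s t : P.AdmTriple, Nontrivial (P.omegaAt s) →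
      (∃ f : P.omegaAt s ≃ₗ[ℂ] P.omegaAt t, ∀ (g : P.G) (v : P.omegaAt s), f (P.rhoAt s g v) = P.rhoAt t g (f v)) →
      s = t)
    (hK : ∃ K : Subgroup P.G, IsOpenCompact K)
    {V : Type} [AddCommGroup V] [Module ℂ V] (ρ : Representation ℂ P.G V) (hρ : IsIrreducibleOrZero ρ) :
    Module.rank ℂ (Representation.IntertwiningMap ρ (P.rhoB τ')) ≤ 1 := by
  by_cases hV : Nontrivial V
  · haveI := isIrreducible_of_isIrreducibleOrZero hρ hV
    obtain ⟨Φ, hΦ⟩ := h hn τ'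
    refine AdmissibleDirectSum.rank_intertwiningMap_le_one_of_equivariant_directSum (σ := fun t => P.rhoAt t) Φ hΦ
      (fun t ht => isIrreducible_of_isIrreducibleOrZero (h411 t).1 ht)
      (fun t => isAdmissible_of_isSmoothRep_of_isAdmissibleRep (h411 t).2.1 (h411 t).2.2)
      (fun s t hs ⟨e⟩ => hsep s t hs ⟨e.toLinearEquiv, fun g v => ?_⟩) ?_
    · rw [Representation.Equiv.toLinearEquiv_apply, Representation.Equiv.toLinearEquiv_apply]
      exact e.toIntertwiningMap.isIntertwining _ _ g v
    · obtain ⟨K, hKo, hKc⟩ := hK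
      exact ⟨K, hKo, hKc⟩
  · -- the zero representation: every intertwiner out of it vanishes
    haveI : Subsingleton V := not_nontrivial_iff_subsingleton.mp hV
    rw [rank_le_one_iff]
    exact ⟨0, fun f => ⟨0, by
      rw [smul_zero]
      exact Representation.IntertwiningMap.ext (LinearMap.ext fun v => by
        rw [Subsingleton.elim v 0, map_zero, map_zero])⟩⟩

/-- **At the summands** (the shape of `MultOneAsPrinted.rank_intertwiningMap_le_one`): under Prop. 4.13 as printed, Def. 4.11,
pairwise non-isomorphy and a compact open subgroup, `dim_ℂ Hom_{ℂ[𝔾(𝔸_F^∞)]}(ω_t, H¹_{B,τ'}(A_∞, ℂ)) ≤ 1` for every admissible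
weight-one triple `t`. [cite: Liu2021, Prop. 4.13 with proof l. 2145; Def. 4.11; Thm. 4.18 (2); App. D Lemma D.1 (3)] -/
theorem rank_intertwiningMap_rhoAt_le_one_of_asPrinted (h : Liu2021.Prop413AsPrinted P) (hn : 3 ≤ P.n) (τ' : E →+* ℂ)
    (h411 : ∀ t : P.AdmTriple,
      IsIrreducibleOrZero (P.rhoAt t) ∧ IsSmoothRep (P.rhoAt t) ∧ IsAdmissibleRep (P.rhoAt t))
    (hsep : ∀ s t : P.AdmTriple, Nontrivial (P.omegaAt s) →
      (∃ f : P.omegaAt s ≃ₗ[ℂ] P.omegaAt t, ∀ (g : P.G) (v : P.omegaAt s), f (P.rhoAt s g v) = P.rhoAt t g (f v)) →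
      s = t)
    (hK : ∃ K : Subgroup P.G, IsOpenCompact K) (t : P.AdmTriple) :
    Module.rank ℂ (Representation.IntertwiningMap (P.rhoAt t) (P.rhoB τ')) ≤ 1 :=
  rank_intertwiningMap_le_one_of_asPrinted h hn τ' h411 hsep hK (P.rhoAt t) (h411 t).1

/-- The same bound in `ℂ[G]`-module currency (the shape of `MultOneAsPrinted.rank_linearMap_asModule_le_one`, i.e. of the
binder `hmult` of `Literature.RepresentationTheory.Liu2021.combinedReading_of_rank_hom_le_one` per summand), through Mathlib's
`Representation.IntertwiningMap.equivLinearMapAsModule`.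
[cite: Liu2021, Prop. 4.13 with proof l. 2145; Def. 4.11; Thm. 4.18 (2); App. D Lemma D.1 (3)] -/
theorem rank_linearMap_asModule_le_one_of_asPrinted (h : Liu2021.Prop413AsPrinted P) (hn : 3 ≤ P.n) (τ' : E →+* ℂ)
    (h411 : ∀ t : P.AdmTriple,
      IsIrreducibleOrZero (P.rhoAt t) ∧ IsSmoothRep (P.rhoAt t) ∧ IsAdmissibleRep (P.rhoAt t))
    (hsep : ∀ s t : P.AdmTriple, Nontrivial (P.omegaAt s) →
      (∃ f : P.omegaAt s ≃ₗ[ℂ] P.omegaAt t, ∀ (g : P.G) (v : P.omegaAt s), f (P.rhoAt s g v) = P.rhoAt t g (f v)) →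
      s = t)
    (hK : ∃ K : Subgroup P.G, IsOpenCompact K) (t : P.AdmTriple) :
    Module.rank ℂ ((P.rhoAt t).asModule →ₗ[MonoidAlgebra ℂ P.G] (P.rhoB τ').asModule) ≤ 1 := by
  rw [← (Representation.IntertwiningMap.equivLinearMapAsModule (P.rhoAt t) (P.rhoB τ')).rank_eq]
  exact rank_intertwiningMap_rhoAt_le_one_of_asPrinted h hn τ' h411 hsep hK t

/-- **At Thm. 4.18's indices over the same carriers** (the shape of `MultOneAsPrinted.rank_intertwiningMap_toThm418Data_le_one`):
for one weight-one `μ` and `R : P.Rest418 μ`, the summand `ω_{(ε,χ)}` of Thm. 4.18 — which IS `ω_{(μ,ε,χ)}` of Prop. 4.13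
(`omegaAt_toThm418Data`) — has multiplicity `≤ 1` in `H¹_{B,τ'}(A_∞, ℂ)`.
[cite: Liu2021, Prop. 4.13 with proof l. 2145; Def. 4.11; Thm. 4.18 and Thm. 4.18 (2); App. D Lemma D.1 (3)] -/
theorem rank_intertwiningMap_toThm418Data_le_one_of_asPrinted (h : Liu2021.Prop413AsPrinted P) (hn : 3 ≤ P.n)
    (h411 : ∀ t : P.AdmTriple,
      IsIrreducibleOrZero (P.rhoAt t) ∧ IsSmoothRep (P.rhoAt t) ∧ IsAdmissibleRep (P.rhoAt t))
    (hsep : ∀ s t : P.AdmTriple, Nontrivial (P.omegaAt s) →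
      (∃ f : P.omegaAt s ≃ₗ[ℂ] P.omegaAt t, ∀ (g : P.G) (v : P.omegaAt s), f (P.rhoAt s g v) = P.rhoAt t g (f v)) →
      s = t)
    (hK : ∃ K : Subgroup P.G, IsOpenCompact K) {μ : IdeleClassGroup E →ₜ* Circle} (R : P.Rest418 μ) (τ' : E →+* ℂ)
    (i : (P.toThm418Data R).AdmIndex) :
    Module.rank ℂ (Representation.IntertwiningMap ((P.toThm418Data R).rhoAt i) (P.rhoB τ')) ≤ 1 :=
  rank_intertwiningMap_rhoAt_le_one_of_asPrinted h hn τ' h411 hsep hK (P.admTripleOf R i)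

/-- **Multiplicity exactly one at a non-zero summand**: under the same inputs, if `ω_t ≠ 0` (App. D Lemma D.1 (1): outside the
excluded case) then `dim_ℂ Hom_{ℂ[𝔾(𝔸_F^∞)]}(ω_t, H¹_{B,τ'}(A_∞, ℂ)) = 1` — the summand embeds through `Φ⁻¹ ∘ ι_t`.
[cite: Liu2021, Prop. 4.13 with proof l. 2145; Def. 4.11; Thm. 4.18 (2); App. D Lemma D.1 (1), (3)] -/
theorem rank_intertwiningMap_rhoAt_eq_one_of_asPrinted (h : Liu2021.Prop413AsPrinted P) (hn : 3 ≤ P.n) (τ' : E →+* ℂ)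
    (h411 : ∀ t : P.AdmTriple,
      IsIrreducibleOrZero (P.rhoAt t) ∧ IsSmoothRep (P.rhoAt t) ∧ IsAdmissibleRep (P.rhoAt t))
    (hsep : ∀ s t : P.AdmTriple, Nontrivial (P.omegaAt s) →
      (∃ f : P.omegaAt s ≃ₗ[ℂ] P.omegaAt t, ∀ (g : P.G) (v : P.omegaAt s), f (P.rhoAt s g v) = P.rhoAt t g (f v)) →
      s = t)
    (hK : ∃ K : Subgroup P.G, IsOpenCompact K) (t : P.AdmTriple) [Nontrivial (P.omegaAt t)] :
    Module.rank ℂ (Representation.IntertwiningMap (P.rhoAt t) (P.rhoB τ')) = 1 := by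
  classical
  obtain ⟨Φ, hΦ⟩ := h hn τ'
  refine AdmissibleDirectSum.rank_intertwiningMap_eq_one_of_equivariant_directSum (σ := fun t => P.rhoAt t) Φ hΦ
    (fun t ht => isIrreducible_of_isIrreducibleOrZero (h411 t).1 ht)
    (fun t => isAdmissible_of_isSmoothRep_of_isAdmissibleRep (h411 t).2.1 (h411 t).2.2)
    (fun s t hs ⟨e⟩ => hsep s t hs ⟨e.toLinearEquiv, fun g v => ?_⟩) ?_ t
  · rw [Representation.Equiv.toLinearEquiv_apply, Representation.Equiv.toLinearEquiv_apply]
    exact e.toIntertwiningMap.isIntertwining _ _ g v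
  · obtain ⟨K, hKo, hKc⟩ := hK
    exact ⟨K, hKo, hKc⟩

/-- **[Liu2021, proof of Prop. 4.13, l. 2145] DERIVED FROM THE STATEMENT**: the typed record `MultOneAsPrinted` («the dimension
of `H¹_{B,τ'}(A_∞, ℂ)[ω(μ,ε,χ)]` is `1`», hitherto NO PROOF) FOLLOWS from Prop. 4.13 as printed together with Def. 4.11's
adjectives of the summands, their pairwise non-isomorphy (Thm. 4.18 (2) + App. D Lemma D.1 (3)), their non-vanishing
(App. D Lemma D.1 (1), the excluded case being absent for `n ≥ 3` admissible weight-one triples — supplied by the consumer as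
`hnv`) and one compact open subgroup of `𝔾(𝔸_F^∞)`.
[cite: Liu2021, Prop. 4.13 (ll. 2113–2119) and proof l. 2145; Def. 4.11; Thm. 4.18 (2); App. D Lemma D.1 (1), (3)] -/
theorem multOneAsPrinted_of_asPrinted (h : Liu2021.Prop413AsPrinted P)
    (h411 : ∀ t : P.AdmTriple,
      IsIrreducibleOrZero (P.rhoAt t) ∧ IsSmoothRep (P.rhoAt t) ∧ IsAdmissibleRep (P.rhoAt t))
    (hsep : ∀ s t : P.AdmTriple, Nontrivial (P.omegaAt s) →
      (∃ f : P.omegaAt s ≃ₗ[ℂ] P.omegaAt t, ∀ (g : P.G) (v : P.omegaAt s), f (P.rhoAt s g v) = P.rhoAt t g (f v)) →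
      s = t)
    (hK : ∃ K : Subgroup P.G, IsOpenCompact K) (hnv : ∀ t : P.AdmTriple, Nontrivial (P.omegaAt t)) :
    P.MultOneAsPrinted := fun hn τ' t => by
  haveI := hnv t
  exact rank_intertwiningMap_rhoAt_eq_one_of_asPrinted h hn τ' h411 hsep hK t

/-- **Where Def. 4.11's record supplies `h411`**: for one weight-one `μ` with rest `R`, `Def411AsPrinted (P.toThm418Data R)`
gives the three adjectives at every index of Thm. 4.18's sum read as a triple of Prop. 4.13 (`admTripleOf`, definitionally the
same module and action).  (A consumer whose `ω` family is typed over all `μ` states the adjectives triple by triple, as `h411`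
above; this lemma records that the per-`μ` record is literally a restriction of that family.) [cite: Liu2021, Def. 4.11] -/
theorem adjectives_admTripleOf_of_def411AsPrinted {μ : IdeleClassGroup E →ₜ* Circle} (R : P.Rest418 μ)
    (h411 : Liu2021.Def411AsPrinted (P.toThm418Data R)) (i : (P.toThm418Data R).AdmIndex) :
    IsIrreducibleOrZero (P.rhoAt (P.admTripleOf R i)) ∧ IsSmoothRep (P.rhoAt (P.admTripleOf R i)) ∧
      IsAdmissibleRep (P.rhoAt (P.admTripleOf R i)) :=
  h411 i.1.1 i.1.2

/-- **The same-`μ` leg of `hsep` IS [Liu2021, Thm. 4.18 (2)] AS PRINTED**: at one weight-one `μ` with rest `R`, two indices of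
Thm. 4.18's sum whose summands — read as summands of Prop. 4.13 along `admTripleOf` (definitionally the same modules and actions)
— are isomorphic are EQUAL, by the conjunct «mutually non-isomorphic» of `Thm418AsPrinted (P.toThm418Data R)`
(`Thm418AsPrinted.eq_of_areIsomorphic`).  (The cross-`μ` leg is App. D Lemma D.1 (3) + local-to-global, not restated here.)
[cite: Liu2021, Thm. 4.18 (2) (l. 2241)] -/
theorem admIndex_eq_of_areIsomorphic_of_thm418AsPrinted {μ : IdeleClassGroup E →ₜ* Circle} (R : P.Rest418 μ)
    (h : Liu2021.Thm418AsPrinted (P.toThm418Data R)) {i j : (P.toThm418Data R).AdmIndex}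
    (hij : ∃ f : P.omegaAt (P.admTripleOf R i) ≃ₗ[ℂ] P.omegaAt (P.admTripleOf R j),
      ∀ (g : P.G) (v : P.omegaAt (P.admTripleOf R i)),
        f (P.rhoAt (P.admTripleOf R i) g v) = P.rhoAt (P.admTripleOf R j) g (f v)) :
    i = j :=
  Thm418Data.eq_of_areIsomorphic h hij

end Prop413Data

/-! ## Appendix (2026-08-23, same seat): the cross-`μ` leg of `hsep` from App. D Lemma D.1 (3) PLACE BY PLACE

The hypothesis `hsep` above (pairwise non-isomorphy of the summands over ALL admissible weight-one triples) has two legs: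
for equal `μ` it is [Liu2021, Thm. 4.18 (2)] as printed (`admIndex_eq_of_areIsomorphic_of_thm418AsPrinted`); across `μ`
it is what [Liu2021] takes from App. D Lemma D.1 (3) («If `n ≥ 3`, then `ω(μ',ε',χ')` is isomorphic to `ω(μ,ε,χ)` if and
only if `(μ',ε',χ')=(μ,ε,χ)`», l. 5233 — a LOCAL statement) through «Statement (2) follows from Lemma D.1» (l. 2270).  The
local-to-global passage is the tree's `Literature.RepresentationTheory.Liu2021.eq_of_equiv` (local isotypy of `ω_t|_{G(F_v)}`
of type `ω_v(t_v)` + local injectivity + «a triple is determined by its local components»); the theorem below is that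
passage in EXACTLY the `hsep` shape consumed by `rank_intertwiningMap_le_one_of_asPrinted`, so that a consumer who models
the local oscillator representations discharges `hsep` from Lemma D.1 (3) per place and nothing else. -/

namespace Prop413Data

variable {F E : Type} [Field F] [NumberField F] [IsTotallyReal F] [Field E] [NumberField E] [Algebra F E]
  [IsTotallyComplex E] [Algebra.IsQuadraticExtension F E] {P : Prop413Data F E}

/-- **`hsep` from App. D Lemma D.1 (3) place by place.**  Data: local groups `Gv v` with `φ v : Gv v →* 𝔾(𝔸_F^∞)`
(Liu: `G(F_v) ⊆ G(𝔸_F^∞)`); local components `loc t v` of an admissible triple `t = (μ,ε,χ)` (Liu: `(μ_v,ε_v,χ_v)`), with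
`loc` injective («`μ = ⊗ μ_v`, `χ = ⊗ χ_v`», Def. 4.11, and the collection `ε = (ε_v)_v`); NON-ZERO irreducible local
oscillator representations `ω v a` (Lemma D.1, first sentence and (1), l. 5227–5229, `n ≥ 3`).  Hypotheses: LOCAL ISOTYPY
`hiso` — `ω_t` restricted along `φ v` is `ω_v(t_v)`-isotypic (what «`ω(μ,ε,χ) := ⊗'_v ω(μ_v,ε_v,χ_v)`», l. 2092–2096, gives;
cf. `eq_of_equiv_of_isRestrictedTensorProductRep`); LOCAL INJECTIVITY `hD` — Lemma D.1 (3) AS PRINTED at each place, in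
`Representation.Equiv` form.  Conclusion: the `hsep` clause — an admissible triple `s` with `ω_s ≠ 0` equivariantly isomorphic
to `ω_t` equals `t`. [cite: Liu2021, App. D Lemma D.1 (3) (l. 5233); Thm. 4.18 (2) and its proof (ll. 2241, 2270); Def. 4.11 (ll. 2092–2096)] -/
theorem admTriple_eq_of_areIsomorphic_of_local {ι : Type} {Gv : ι → Type} [∀ v, Group (Gv v)]
    (φ : ∀ v, Gv v →* P.G) {Ploc : ι → Type} {loc : P.AdmTriple → ∀ v, Ploc v} (hloc : Function.Injective loc)
    {Vloc : ∀ v, Ploc v → Type} [∀ v a, AddCommGroup (Vloc v a)] [∀ v a, Module ℂ (Vloc v a)]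
    (ω : ∀ v a, Representation ℂ (Gv v) (Vloc v a)) [∀ v a, (ω v a).IsIrreducible]
    (hiso : ∀ (t : P.AdmTriple) (v : ι),
      isotypicComponent (MonoidAlgebra ℂ (Gv v)) (Representation.asModule ((P.rhoAt t).comp (φ v)))
        (ω v (loc t v)).asModule = ⊤)
    (hD : ∀ (v : ι) (a b : Ploc v), Nonempty ((ω v a).Equiv (ω v b)) → a = b)
    (s t : P.AdmTriple) (hs : Nontrivial (P.omegaAt s))
    (hst : ∃ f : P.omegaAt s ≃ₗ[ℂ] P.omegaAt t, ∀ (g : P.G) (v : P.omegaAt s), f (P.rhoAt s g v) = P.rhoAt t g (f v)) :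
    s = t := by
  obtain ⟨f, hf⟩ := hst
  haveI := hs
  exact Literature.RepresentationTheory.Liu2021.eq_of_equiv φ hloc (fun t => P.rhoAt t) ω hiso hD
    (Representation.Equiv.mk f fun g => LinearMap.ext (hf g))

end Prop413Data

end Literature.NumberTheory.Automorphic.Liu2021

end
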